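import Summits.AtomisticToContinuum.BoseEinsteinCondensation.Theses.BECHeatBathGap
import Literature.Analysis.FunctionSpaces.NuclearSpace
import Summits.AtomisticToContinuum.BoseEinsteinCondensation.Theorems.ParticleTensorisation.Negative.PosdefDressingFalse

/-!
# Crux `ParticleTensorisation` (stmt-AtomisticToContinuum-14367) — birth skeleton (BC3), line `birth-posdef-undressing`

Route: `route-AtomisticToContinuum-BECHeatBathGap` (rank-2 crux, card A1; skeleton registrar
planner-skel-stmt-AtomisticToContinuum-14367-0, 2026-08-17). The crux, fixed and concluded BY NAME
below (`Theses.BECHeatBathGap.ParticleTensorisation`): for every repulsive finite-range `v` there are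
`ρ₀ > 0` and ONE constant `C` such that for `0 < ρ < ρ₀`, all large `N` and EVERY slack `δ > 0`, SOME
`δ`-near-minimiser `Θ` of the `N`-body Dirichlet energy in the box of side `((N+1)/ρ)^{1/3}` satisfies
approximate tensorisation (AT) of variance over PARTICLE LABELS with constant `C`, in the
division-free predictor form `min_c ∫_{Λ^N} |F − cΘ|² ≤ C Σ_i ∫_{Λ^N} |F − g_i Θ|²` (bounded
measurable `F`, bounded measurable predictors `g_i` not depending on `x_i`), i.e. the heat-bath
(Gibbs-sampler) spectral gap of the Born law `|Θ|²` is `≥ 1/C` uniformly in `N`.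

## Why the catalogued criteria do not cut it (route header, why-might-fail of the crux)

The one-particle TV influence of `x_j` on the conditional law of `x_i` under `|Ψ₀|²` is dominated by
the Reatto–Chester `r⁻²` tail of the pair pseudo-potential (`1 − f² ~ b²/r²`, `b² = c/(2π²ρ)`), whose
box integral grows like `L`: Dobrushin row sums `~ ρ b² L → ∞` (Wu 2004/2006; Dyer–Goldberg–Jerrum
matrix norms alike), the low-activity cluster criteria (Bertini–Cancrini–Cesi 2002,
Kondratiev–Kuna–Ohlerich 2013, Michelen–Perkins 2022) fail for the same reason, and Holley–Stroock
is useless (extensive log-density errors). What the tail HAS is a sign: in Bogoliubov /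
Reatto–Chester theory the long-range part of `−log |Ψ₀|²` is the zero-point PHONON Gaussian
`(1/4N) Σ_k (1/S(k) − 1) |ρ_k|²` with `S(k) = k²/√(k⁴ + 16πρa k²) ≤ 1`, i.e. a pair term
`Σ_{k<l} U(x_k − x_l)` with `U` POSITIVE-DEFINITE (Bochner) and of small amplitude
`U(0) ~ b²/(ξ/3)² ~ √(ρa³)` once the region `r ≲ ξ/3` is left to the short-range factor. Positive
type is exactly the Gates–Penrose "no mean-field transition" class, and for the heat bath its
collective modes relax FASTER (hyperuniform modes; the route's own toy check (i)); the only cost is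
the per-site amplitude (Gaussian Gibbs-sampler computation: precision `I + 2λJ` costs the factor
`1 + 2λ`, the collective strength `λN` is harmless).

## The cut (two registered stubs, both load-bearing; composition = instantiation)

* `stub_posdefDressing` — CRITERION (classical probability / functional inequalities; NEW as a
  statement; size L): amplitude threshold `u₀` and absolute factor `C₀` such that undressing by ANY
  continuous even positive-definite `U` with `|U| ≤ u₀` can improve the AT constant of ANY measurable
  amplitude `A` on `Λ_L^N` by at most `C₀`: `AT_L(C₁; A·e^{+½ΣU}) → AT_L(C₀C₁; A)`, all `N`, `L`.
  Why it might fail: a reference law `|A|²e^{ΣU}` with hidden near-degenerate structure that the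
  dressing tips over (the Gaussian and antiferromagnetic Curie–Weiss toys say the cost is `e^{O(u₀)}`).
  Cheapest falsifier: two-well product law × `U = u₀ cos(k·x)` (cost `e^{2u₀}`, passes by hand), then a
  certified `N ≤ 4`, `d = 1` Gibbs-sampler gap sweep over positive-type `U` (one `kit` job).
* `stub_undressedWitness` — VERIFICATION (quantum many-body; the HARDEST stub; open-problem size):
  for every `v` and EVERY threshold `u₀ > 0`, at small density, large `N` and every slack, some
  near-minimiser `Θ` and some admissible `U` (`|U| ≤ u₀`) with `AT(C₁; Θ·e^{+½ΣU})`, `C₁ = C₁(v, u₀)`: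
  "after dividing the phonon Gaussian out of `|Θ|²`, the rest is in the Dobrushin regime uniformly in
  `N`" (core Jastrow `α ≈ 1/18`, one-body boundary layer, dressed three-body remainder). Strictly
  WEAKER than the crux (`U = 0` allowed), useless without the criterion. Why it might fail: the
  non-Gaussian long-range remainder of `log |Ψ₀|²` (three-phonon terms) need not have Dobrushin-small
  per-particle norms — the uncharted part of the crux, now isolated as a SHORT-RANGE question.

Composition: `particleTensorisation_of_stubs` (stub statements ⟹ crux body: `u₀, C₀` from the
criterion, `ρ₀, C₁` from the witness at `u₀`, `C := C₀C₁`, criterion applied at `A := Θ.ψ`, measurable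
because `C¹`) and `ParticleTensorisation_of : Theses.BECHeatBathGap.ParticleTensorisation` — the ONLY
theorem here concluding the crux by name, fed with the two stubs; `sorry` occurs in the two stubs only.

Disproof used: none exists for this crux (`ledger crux ls stmt-AtomisticToContinuum-14367`: no
`Disproof.lean`, no dead lines, 2026-08-17). Negatives index: the only BEC negative (SwapJensen,
stmt-3980) is a sign exploit in another engine; no stub restates it, no free real constant enters a
conclusion unguarded (`C₀, C₁, u₀` are positive and bound the right-hand sides). Corners: `N = 0`
(both AT clauses reduce to `A X₀ ≠ 0`, consistent), `L ≤ 0` (empty box, all integrals `0`),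
`U ≡ const ≥ 0` (positive-definite; undressing is a constant factor; needs `C₀ ≥ 1`, allowed),
`A ≡ 0` (`AT(C)` iff `C·N ≥ 1`, same on both sides) — no junk truth values found.

References: Efron–Stein 1981; Caputo–Menz–Tetali 2015 (approximate tensorisation); Wu 2006,
Bertini–Cancrini–Cesi 2002, Kondratiev–Kuna–Ohlerich 2013, Michelen–Perkins 2022 (continuum
Gibbs samplers, low activity); Bauerschmidt–Bodineau 2019 (covariance-decomposition proofs of
functional inequalities); Gates–Penrose 1970 (positive-type Kac potentials); Reatto–Chester 1967,
Bogoliubov 1947, LSSY 2005 (phonon Gaussian, `S(k) ≤ 1`); Bochner 1933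
(`Literature.Analysis.FunctionSpaces.IsPositiveDefinite`).
-/

noncomputable section

open MeasureTheory Filter
open scoped ENNReal NNReal ComplexConjugate

namespace Summit.AtomisticToContinuum.BoseEinsteinCondensation.Cruxes.ParticleTensorisation.BirthPosdefUndressing

open Literature.MathematicalPhysics.QuantumManyBody.BoseGas

/-! ## Registered stubs

Notation used informally in the docstrings (everything is INLINED in the statements, over existing
declarations only): `AT_L(C; B)` is the crux's division-free approximate-tensorisation clause for an
amplitude `B : Λ^N → ℂ` in the box `Λ_L^N` — for all bounded measurable `F` and bounded measurable
predictors `g_i` with `g_i (update X i x) = g_i X`,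
`∃ c, ∫_{Λ_L^N} ‖F − c·B‖² ≤ C · Σ_i ∫_{Λ_L^N} ‖F − g_i·B‖²` — with `B = Θ.ψ`, `L = sideLength ρ (N+1)`
it is LITERALLY the clause of `Theses.BECHeatBathGap.ParticleTensorisation`; and the UNDRESSED amplitude
of `B` by a pair kernel `U` is `X ↦ B X · exp(+½ Σ_{k<l} U(X k − X l))`, whose Born law is
`|B|² e^{+Σ_{k<l}U}` (the pair Gaussian dressing `e^{−Σ_{k<l}U}` divided out of `|B|²`). -/

/-- **Stub 1 — positive-definite dressing preserves approximate tensorisation (criterion).**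
There are an amplitude threshold `u₀ > 0` and a factor `C₀ > 0` such that for all `N`, `L`, every
measurable amplitude `A` on `Λ^N` and every continuous, even, positive-definite (Bochner) pair kernel
`U : ℝ³ → ℝ` with `|U| ≤ u₀`: `AT_L(C₁; A·e^{+½Σ_{k<l}U}) → AT_L(C₀C₁; A)` — a small-amplitude
positive-type pair Gaussian dressing `e^{−Σ_{k<l}U(x_k−x_l)}` cannot close the heat-bath gap by more
than the factor `C₀`. Heuristics: Gaussian Gibbs-sampler computation (precision `I + 2λJ`: cost `1 + 2λ`
from the per-site amplitude, the collective strength `λN` is harmless), hyperuniform collective modes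
relax faster (route toy (i)), Gates–Penrose (positive type = no mean-field transition, so no caging at
any density once `ε/T ≤ u₀`); NOT in print — the known continuum Gibbs-sampler gaps are low-activity
(Bertini–Cancrini–Cesi 2002, Wu 2006, Kondratiev–Kuna–Ohlerich 2013, Michelen–Perkins 2022). In the
product case it contains: high-temperature positive-type pair fluids tensorise uniformly at ALL
densities. Size L. Corners: `U ≡ const ≥ 0` (undressing is a constant factor: needs `C₀ ≥ 1`, allowed),
`N = 0` (both clauses say `A X₀ ≠ 0`), `L ≤ 0` (empty box), `A ≡ 0` (`C N ≥ 1` on both sides). -/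
theorem stub_posdefDressing :
    ∃ u₀ : ℝ, 0 < u₀ ∧ ∃ C₀ : ℝ, 0 < C₀ ∧ ∀ (N : ℕ) (L : ℝ) (A : (Fin N → EuclideanSpace ℝ (Fin 3))
      → ℂ), Measurable A → ∀ U : EuclideanSpace ℝ (Fin 3) → ℝ, Continuous U → (∀ x, U (-x) = U x) →
      Literature.Analysis.FunctionSpaces.IsPositiveDefinite (fun x => (U x : ℂ)) → (∀ x, |U x| ≤ u₀)
      → ∀ C₁ : ℝ, 0 < C₁ → (∀ (F : (Fin N → EuclideanSpace ℝ (Fin 3)) → ℂ) (g : Fin N → (Fin N →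
      EuclideanSpace ℝ (Fin 3)) → ℂ), Measurable F → (∀ i, Measurable (g i)) → (∃ M : ℝ, ∀ X, ‖F X‖
      ≤ M ∧ ∀ i, ‖g i X‖ ≤ M) → (∀ i X x, g i (Function.update X i x) = g i X) → ∃ c : ℂ, (∫⁻ X in
      boxN N L, (‖F X - c * (A X * (Real.exp ((∑ k : Fin N, ∑ l : Fin N with k < l, U (X k - X l)) /
      2) : ℂ))‖₊ : ℝ≥0∞) ^ 2) ≤ ENNReal.ofReal C₁ * ∑ i : Fin N, ∫⁻ X in boxN N L, (‖F X - g i X *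
      (A X * (Real.exp ((∑ k : Fin N, ∑ l : Fin N with k < l, U (X k - X l)) / 2) : ℂ))‖₊ : ℝ≥0∞) ^
      2) → (∀ (F : (Fin N → EuclideanSpace ℝ (Fin 3)) → ℂ) (g : Fin N → (Fin N → EuclideanSpace ℝ
      (Fin 3)) → ℂ), Measurable F → (∀ i, Measurable (g i)) → (∃ M : ℝ, ∀ X, ‖F X‖ ≤ M ∧ ∀ i, ‖g i
      X‖ ≤ M) → (∀ i X x, g i (Function.update X i x) = g i X) → ∃ c : ℂ, (∫⁻ X in boxN N L, (‖F X -
      c * A X‖₊ : ℝ≥0∞) ^ 2) ≤ ENNReal.ofReal (C₀ * C₁) * ∑ i : Fin N, ∫⁻ X in boxN N L, (‖F X - g i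
      X * A X‖₊ : ℝ≥0∞) ^ 2) := by
  sorry

/-- **Stub 2 — undressed witnesses at every slack (verification; the HARDEST stub).** For every
repulsive finite-range `v` and EVERY amplitude threshold `u₀ > 0` there are `ρ₀ > 0` and `C₁ > 0` such
that for `0 < ρ < ρ₀`, all large `N` and every slack `δ > 0`, SOME `δ`-near-minimiser `Θ` of the `N`-body
Dirichlet energy in the box of side `((N+1)/ρ)^{1/3}` admits a continuous, even, positive-definite pair
kernel `U` with `|U| ≤ u₀` — the Bogoliubov / Reatto–Chester zero-point phonon Gaussian,
`û ∝ (1/S(k) − 1)/ρ ≥ 0` because `S(k) = k²/√(k⁴ + 16πρa k²) ≤ 1`, amplitude `U(0) ~ b²/(ξ/3)² ~ √(ρa³)`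
— such that `AT_L(C₁; Θ·e^{+½Σ_{k<l}U})`: after dividing the phonon Gaussian out of `|Θ|²`, what is
left (core Jastrow factor with Dobrushin parameter `α ≈ 4πρa(ξ/3)² = 1/18 < 1/5`, one-body boundary
layer, dressed three-body remainder) tensorises uniformly in `N` (Dobrushin regime; cf. the landed
`JastrowDobrushinRung_holds` mechanism). `∀ u₀` stands BEFORE `∃ ρ₀` because `U(0) → 0` as `ρ → 0`.
Strictly weaker than the crux (`U = 0` is allowed) and useless without Stub 1. Why it might fail: the
non-Gaussian long-range remainder of `log |Ψ₀|²` (three-phonon terms) need not have Dobrushin-small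
per-particle norms — the uncharted part of the crux, now isolated as a SHORT-RANGE question.
Open-problem size. -/
theorem stub_undressedWitness :
    ∀ v : ℝ → ℝ≥0∞, IsRepulsiveFiniteRange v → ∀ u₀ : ℝ, 0 < u₀ → ∃ ρ₀ : ℝ, 0 < ρ₀ ∧ ∃ C₁ : ℝ, 0 <
      C₁ ∧ ∀ ρ : ℝ, 0 < ρ → ρ < ρ₀ → ∀ᶠ N : ℕ in atTop, ∀ δ : ℝ≥0∞, 0 < δ → ∃ Θ : TrialState N
      (sideLength ρ (N + 1)), energy v Θ ≤ groundStateEnergy v N (sideLength ρ (N + 1)) + δ ∧ ∃ U :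
      EuclideanSpace ℝ (Fin 3) → ℝ, Continuous U ∧ (∀ x, U (-x) = U x) ∧
      Literature.Analysis.FunctionSpaces.IsPositiveDefinite (fun x => (U x : ℂ)) ∧ (∀ x, |U x| ≤ u₀)
      ∧ (∀ (F : (Fin N → EuclideanSpace ℝ (Fin 3)) → ℂ) (g : Fin N → (Fin N → EuclideanSpace ℝ (Fin
      3)) → ℂ), Measurable F → (∀ i, Measurable (g i)) → (∃ M : ℝ, ∀ X, ‖F X‖ ≤ M ∧ ∀ i, ‖g i X‖ ≤
      M) → (∀ i X x, g i (Function.update X i x) = g i X) → ∃ c : ℂ, (∫⁻ X in boxN N (sideLength ρ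
      (N + 1)), (‖F X - c * (Θ.ψ X * (Real.exp ((∑ k : Fin N, ∑ l : Fin N with k < l, U (X k - X l))
      / 2) : ℂ))‖₊ : ℝ≥0∞) ^ 2) ≤ ENNReal.ofReal C₁ * ∑ i : Fin N, ∫⁻ X in boxN N (sideLength ρ (N +
      1)), (‖F X - g i X * (Θ.ψ X * (Real.exp ((∑ k : Fin N, ∑ l : Fin N with k < l, U (X k - X l))
      / 2) : ℂ))‖₊ : ℝ≥0∞) ^ 2) := by
  sorry

/-! ## The composition (kernel-checked, no `sorry` of its own) -/

/-- **The two stub statements imply the crux statement** (conclusion = the body of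
`Theses.BECHeatBathGap.ParticleTensorisation`, spelled out so that exactly one theorem of this file,
`ParticleTensorisation_of`, concludes the crux by name): take `u₀, C₀` from the criterion, `ρ₀, C₁`
from the witness at threshold `u₀`, `C := C₀ C₁`; eventually in `N`, for every slack the witness
`Θ, U` and the criterion at the measurable (`C¹`) amplitude `Θ.ψ` give the AT clause literally.
[folklore] -/
theorem particleTensorisation_of_stubs
    (h1 : ∃ u₀ : ℝ, 0 < u₀ ∧ ∃ C₀ : ℝ, 0 < C₀ ∧ ∀ (N : ℕ) (L : ℝ) (A : (Fin N → EuclideanSpace ℝ (Fin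
      3)) → ℂ), Measurable A → ∀ U : EuclideanSpace ℝ (Fin 3) → ℝ, Continuous U → (∀ x, U (-x) = U
      x) → Literature.Analysis.FunctionSpaces.IsPositiveDefinite (fun x => (U x : ℂ)) → (∀ x, |U
      x| ≤ u₀) → ∀ C₁ : ℝ, 0 < C₁ → (∀ (F : (Fin N → EuclideanSpace ℝ (Fin 3)) → ℂ) (g : Fin N →
      (Fin N → EuclideanSpace ℝ (Fin 3)) → ℂ), Measurable F → (∀ i, Measurable (g i)) → (∃ M : ℝ,
      ∀ X, ‖F X‖ ≤ M ∧ ∀ i, ‖g i X‖ ≤ M) → (∀ i X x, g i (Function.update X i x) = g i X) → ∃ c :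
      ℂ, (∫⁻ X in boxN N L, (‖F X - c * (A X * (Real.exp ((∑ k : Fin N, ∑ l : Fin N with k < l, U
      (X k - X l)) / 2) : ℂ))‖₊ : ℝ≥0∞) ^ 2) ≤ ENNReal.ofReal C₁ * ∑ i : Fin N, ∫⁻ X in boxN N L,
      (‖F X - g i X * (A X * (Real.exp ((∑ k : Fin N, ∑ l : Fin N with k < l, U (X k - X l)) / 2)
      : ℂ))‖₊ : ℝ≥0∞) ^ 2) → (∀ (F : (Fin N → EuclideanSpace ℝ (Fin 3)) → ℂ) (g : Fin N → (Fin N →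
      EuclideanSpace ℝ (Fin 3)) → ℂ), Measurable F → (∀ i, Measurable (g i)) → (∃ M : ℝ, ∀ X, ‖F
      X‖ ≤ M ∧ ∀ i, ‖g i X‖ ≤ M) → (∀ i X x, g i (Function.update X i x) = g i X) → ∃ c : ℂ, (∫⁻ X
      in boxN N L, (‖F X - c * A X‖₊ : ℝ≥0∞) ^ 2) ≤ ENNReal.ofReal (C₀ * C₁) * ∑ i : Fin N, ∫⁻ X
      in boxN N L, (‖F X - g i X * A X‖₊ : ℝ≥0∞) ^ 2))
    (h2 : ∀ v : ℝ → ℝ≥0∞, IsRepulsiveFiniteRange v → ∀ u₀ : ℝ, 0 < u₀ → ∃ ρ₀ : ℝ, 0 < ρ₀ ∧ ∃ C₁ : ℝ, 0 <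
      C₁ ∧ ∀ ρ : ℝ, 0 < ρ → ρ < ρ₀ → ∀ᶠ N : ℕ in atTop, ∀ δ : ℝ≥0∞, 0 < δ → ∃ Θ : TrialState N
      (sideLength ρ (N + 1)), energy v Θ ≤ groundStateEnergy v N (sideLength ρ (N + 1)) + δ ∧ ∃ U
      : EuclideanSpace ℝ (Fin 3) → ℝ, Continuous U ∧ (∀ x, U (-x) = U x) ∧
      Literature.Analysis.FunctionSpaces.IsPositiveDefinite (fun x => (U x : ℂ)) ∧ (∀ x, |U x| ≤
      u₀) ∧ (∀ (F : (Fin N → EuclideanSpace ℝ (Fin 3)) → ℂ) (g : Fin N → (Fin N → EuclideanSpace ℝ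
      (Fin 3)) → ℂ), Measurable F → (∀ i, Measurable (g i)) → (∃ M : ℝ, ∀ X, ‖F X‖ ≤ M ∧ ∀ i, ‖g i
      X‖ ≤ M) → (∀ i X x, g i (Function.update X i x) = g i X) → ∃ c : ℂ, (∫⁻ X in boxN N
      (sideLength ρ (N + 1)), (‖F X - c * (Θ.ψ X * (Real.exp ((∑ k : Fin N, ∑ l : Fin N with k <
      l, U (X k - X l)) / 2) : ℂ))‖₊ : ℝ≥0∞) ^ 2) ≤ ENNReal.ofReal C₁ * ∑ i : Fin N, ∫⁻ X in boxN
      N (sideLength ρ (N + 1)), (‖F X - g i X * (Θ.ψ X * (Real.exp ((∑ k : Fin N, ∑ l : Fin N with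
      k < l, U (X k - X l)) / 2) : ℂ))‖₊ : ℝ≥0∞) ^ 2)) :
    ∀ v : ℝ → ℝ≥0∞, IsRepulsiveFiniteRange v → ∃ ρ₀ : ℝ, 0 < ρ₀ ∧ ∃ C : ℝ, 0 < C ∧ ∀ ρ : ℝ, 0 < ρ →
      ρ < ρ₀ → ∀ᶠ N : ℕ in Filter.atTop, ∀ δ : ℝ≥0∞, 0 < δ → ∃ Θ : TrialState N (sideLength ρ (N +
      1)), energy v Θ ≤ groundStateEnergy v N (sideLength ρ (N + 1)) + δ ∧ ∀ (F : (Fin N →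
      EuclideanSpace ℝ (Fin 3)) → ℂ) (g : Fin N → (Fin N → EuclideanSpace ℝ (Fin 3)) → ℂ),
      Measurable F → (∀ i, Measurable (g i)) → (∃ M : ℝ, ∀ X, ‖F X‖ ≤ M ∧ ∀ i, ‖g i X‖ ≤ M) → (∀ i X
      x, g i (Function.update X i x) = g i X) → ∃ c : ℂ, (∫⁻ X in boxN N (sideLength ρ (N + 1)), (‖F
      X - c * Θ.ψ X‖₊ : ℝ≥0∞) ^ 2) ≤ ENNReal.ofReal C * ∑ i : Fin N, ∫⁻ X in boxN N (sideLength ρ (N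
      + 1)), (‖F X - g i X * Θ.ψ X‖₊ : ℝ≥0∞) ^ 2 := by
  intro v hv
  obtain ⟨u₀, hu₀, C₀, hC₀, hcrit⟩ := h1
  obtain ⟨ρ₀, hρ₀, C₁, hC₁, hw⟩ := h2 v hv u₀ hu₀
  refine ⟨ρ₀, hρ₀, C₀ * C₁, mul_pos hC₀ hC₁, fun ρ hρ hρlt => ?_⟩
  filter_upwards [hw ρ hρ hρlt] with N hN
  intro δ hδ
  obtain ⟨Θ, hE, U, hUc, hUe, hUpd, hUb, hAT⟩ := hN δ hδ
  exact ⟨Θ, hE, hcrit N _ Θ.ψ Θ.contDiff.continuous.measurable U hUc hUe hUpd hUb C₁ hC₁ hAT⟩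

/-- **`ParticleTensorisation` from the two registered stubs** — the crux BY NAME
(`Summit.AtomisticToContinuum.BoseEinsteinCondensation.Theses.BECHeatBathGap.ParticleTensorisation`);
its only `sorry`s are those of `stub_posdefDressing` and `stub_undressedWitness`, so it closes the crux
the day both stubs are theorems. [folklore] -/
theorem ParticleTensorisation_of : Theses.BECHeatBathGap.ParticleTensorisation :=
  particleTensorisation_of_stubs stub_posdefDressing stub_undressedWitness


/-! ## Lead c2 (2026-08-17): the registered line is DEAD — kernel check

The criterion stub's REGISTERED signature is, verbatim, the statement negated by the landed theorem
`Theorems.PosdefDressingNeg.stub_posdefDressing_false` (p146152, accepted): the application below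
type-checks, so the skeleton's composition rests on a refuted stub. (This file keeps the two stub
`sorry`s; it is a consistency check of the LINE, not a result toward the crux.) -/

/-- The registered stub `stub_posdefDressing` contradicts the landed refutation
`PosdefDressingNeg.stub_posdefDressing_false`; elaboration of this term certifies that the two
signatures coincide. [folklore] -/
theorem registered_line_dead : False :=
  _root_.Summit.AtomisticToContinuum.BoseEinsteinCondensation.Theorems.PosdefDressingNeg.stub_posdefDressing_false
    stub_posdefDressing

end Summit.AtomisticToContinuum.BoseEinsteinCondensation.Cruxes.ParticleTensorisation.BirthPosdefUndressing

end
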